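import Mathlib
import HarnessLib
import Summits.ValiantsHypothesis.ValiantsHypothesis.Theses.IntegralOrbits
import Summits.ValiantsHypothesis.ValiantsHypothesis.Theorems.IntegralOrbitsIntDetGlue
import Summits.ValiantsHypothesis.ValiantsHypothesis.Theorems.IntegralOrbitsHeightToSize
import Summits.ValiantsHypothesis.ValiantsHypothesis.Theorems.IntegralOrbitsIntDetQPShortWordBasis
import Summits.ValiantsHypothesis.ValiantsHypothesis.Theorems.IntegralOrbitsIntDetQPRegularPencilDet
import Summits.ValiantsHypothesis.ValiantsHypothesis.Theorems.IntegralOrbitsIntDetQPTraceCramer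
import Summits.ValiantsHypothesis.ValiantsHypothesis.Theorems.IntegralOrbitsIntDetQPAdjugateEntryBound
import Summits.ValiantsHypothesis.ValiantsHypothesis.Theorems.IntegralOrbitsIntDetQPLiftAssembly
import Summits.ValiantsHypothesis.ValiantsHypothesis.Theorems.IntegralOrbitsIntDetQPGlueFreeDenominator

/-!
# Skeleton v3 (lead reshape of the BC3 birth skeleton; wave 1 landed) for crux `IntegralOrbits.IntDetQP`
(stmt-ValiantsHypothesis-7677), line `birth`

Composition idea unchanged (rational character ⇒ integral regular model ⇒ landed glue ⇒ crux),
with ONE reshape: the lift is asked for with a FREE bounded denominator `D` (any `1 ≤ D ≤ 2^poly`)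
instead of a power `N^e` of the character's `N`. The glue only ever needed `N' ≠ 0`
(`IntDetQP` allows any nonzero integer multiplier), so the order-theoretic part of
`IntegralCharacterLift` (Λ-stable lattice, HNF) is not needed for the crux: the word-basis /
trace-form Cramer argument gives the free-denominator lift directly, with `D = |det Gram|`.

Stubs (after wave 1 the ONLY `sorry` left is `stub_rationalCharacterNF`; the six others are
references to the landed `--supports` theorems p148778 p147241 p147102 p147055 p149878 p148645):
* `stub_rationalCharacterNF` — verbatim route item `RationalCharacterNF` (stmt-7678, open-problem
  grade; held by the lead).
* `stub_shortWordBasis` — words of length `≤ m²` contain a basis of `M_m(ℂ)` when all words span.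
* `stub_regularPencilDet` — the generic pencil of the left-regular representation written in ANY
  basis `b` of `M_m(ℂ)` has determinant `det(X₀ + Σ X_v M_v)^m` (conjugation + block diagonal).
* `stub_traceCramer` — the coordinates solve the Gram system of the trace form:
  `det G ≠ 0` and `det G • C_v = adj G * T_v`.
* `stub_adjugateEntryBound` — `|det A|, |adj A i j| ≤ n!·K^n` for an integer matrix with
  `|A i j| ≤ K`, `1 ≤ K`.
* `stub_liftAssembly` — the four statements above imply the FREE-DENOMINATOR LIFT.
* `stub_glueFreeDenominator` — `RationalCharacterNF → LiftFD → HeightToSize → IntDetQP`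
  (the landed glue `Theorems.intDetGlue_proof` re-run with `D` in place of `N^e`).

`IntDetQP_of` composes them (pure logic) with the landed `Theorems.heightToSize_proof`.
-/

set_option linter.dupNamespace false -- single-conjunct summit: `ValiantsHypothesis.ValiantsHypothesis`

noncomputable section

namespace Summit.ValiantsHypothesis.ValiantsHypothesis.Cruxes.IntDetQP.Birth

open scoped BigOperators Topology Manifold Classical MeasureTheory ProbabilityTheory Matrix InnerProductSpace ComplexConjugate ContinuousMap
open Filter Set Function TopologicalSpace MeasureTheory
open Summit.ValiantsHypothesis.ValiantsHypothesis.Theses.IntegralOrbits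

/-! ## §1 The registered stubs (`sorry` lives only here) -/

/-- **Stub NF (registered, unchanged)** — verbatim the route item `IntegralOrbits.RationalCharacterNF`
(stmt-ValiantsHypothesis-7678, open-problem grade): the Diophantine core, held by the lead. -/
theorem stub_rationalCharacterNF :
    ∃ c : ℕ, ∀ (n m : ℕ),
      Literature.Computability.AlgebraicComplexity.HasDetRepr
          (Literature.Computability.AlgebraicComplexity.perPoly (Fin n) ℂ) m →
        ∃ (m' N h : ℕ) (M : Fin n × Fin n → Matrix (Fin m') (Fin m') ℂ),
          m' ≤ 2 ^ ((Nat.log 2 m + c) ^ c) ∧ 1 ≤ N ∧ N ≤ 2 ^ h ∧ h ≤ 2 ^ ((Nat.log 2 m + c) ^ c) ∧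
          ((1 : Matrix (Fin m') (Fin m') (MvPolynomial (Fin n × Fin n) ℂ)) +
              ∑ v : Fin n × Fin n, (MvPolynomial.X v - MvPolynomial.C (if v.1 = v.2 then (1 : ℂ) else 0)) •
                (M v).map (MvPolynomial.C : ℂ →+* MvPolynomial (Fin n × Fin n) ℂ)).det =
            Literature.Computability.AlgebraicComplexity.perPoly (Fin n) ℂ ∧
          Submodule.span ℂ (Set.range fun w : List (Fin n × Fin n) => (w.map M).prod) = ⊤ ∧
          ∀ w : List (Fin n × Fin n), ∃ (z : ℤ) (e : ℕ),
            ((w.map M).prod).trace = (z : ℂ) / (N : ℂ) ^ e ∧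
              |z| ≤ 2 ^ (h * (w.length + 1)) ∧ e ≤ h * (w.length + 1) := by
  sorry

/-- **Stub L1 (short word basis)**: if the words in a tuple `M : ι → M_m(ℂ)` span `M_m(ℂ)`, then
`m²` words of length `≤ m·m` already form a basis (the span of words of length `≤ ℓ` strictly grows
until it stabilises). -/
theorem stub_shortWordBasis :
    ∀ (ι : Type) [Fintype ι] [DecidableEq ι] (m : ℕ) (M : ι → Matrix (Fin m) (Fin m) ℂ),
      Submodule.span ℂ (Set.range fun w : List ι => (w.map M).prod) = ⊤ →
      ∃ b : Fin m × Fin m → List ι,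
        (∀ i, (b i).length ≤ m * m) ∧ LinearIndependent ℂ (fun i => ((b i).map M).prod) :=
  Summit.ValiantsHypothesis.ValiantsHypothesis.Theorems.stub_shortWordBasis

/-- **Stub L2 (regular pencil determinant)**: if `b` is a basis of `M_m(ℂ)` (a linearly independent
family indexed by `Fin m × Fin m`) and `C_v` is the matrix of left multiplication by `M_v` in that
basis, then `det (X₀·1 + Σ_v X_v C_v) = det (X₀·1 + Σ_v X_v M_v)^m` (change of basis to the standard
basis, where left multiplication is block diagonal with `m` copies of `M_v`). -/
theorem stub_regularPencilDet :
    ∀ (ι : Type) [Fintype ι] [DecidableEq ι] (m : ℕ) (M : ι → Matrix (Fin m) (Fin m) ℂ)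
      (b : Fin m × Fin m → Matrix (Fin m) (Fin m) ℂ)
      (Cv : ι → Matrix (Fin m × Fin m) (Fin m × Fin m) ℂ),
      LinearIndependent ℂ b →
      (∀ v j, M v * b j = ∑ i, Cv v i j • b i) →
      ((MvPolynomial.X none : MvPolynomial (Option ι) ℂ) •
            (1 : Matrix (Fin m × Fin m) (Fin m × Fin m) (MvPolynomial (Option ι) ℂ)) +
          ∑ v : ι, (MvPolynomial.X (some v) : MvPolynomial (Option ι) ℂ) •
            (Cv v).map (MvPolynomial.C : ℂ →+* MvPolynomial (Option ι) ℂ)).det =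
        (((MvPolynomial.X none : MvPolynomial (Option ι) ℂ) •
              (1 : Matrix (Fin m) (Fin m) (MvPolynomial (Option ι) ℂ)) +
            ∑ v : ι, (MvPolynomial.X (some v) : MvPolynomial (Option ι) ℂ) •
              (M v).map (MvPolynomial.C : ℂ →+* MvPolynomial (Option ι) ℂ)).det) ^ m :=
  Summit.ValiantsHypothesis.ValiantsHypothesis.Theorems.stub_regularPencilDet

/-- **Stub L3 (trace-form Cramer)**: with `G i j = tr (b_i b_j)` and `T_v i j = tr (b_i M_v b_j)`,
linearity of the trace gives `G * C_v = T_v`; the trace pairing on `M_m(ℂ)` is nondegenerate and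
`b` is a basis, so `det G ≠ 0` and `det G • C_v = adj G * T_v`. -/
theorem stub_traceCramer :
    ∀ (ι : Type) [Fintype ι] [DecidableEq ι] (m : ℕ) (M : ι → Matrix (Fin m) (Fin m) ℂ)
      (b : Fin m × Fin m → Matrix (Fin m) (Fin m) ℂ)
      (Cv : ι → Matrix (Fin m × Fin m) (Fin m × Fin m) ℂ),
      LinearIndependent ℂ b →
      (∀ v j, M v * b j = ∑ i, Cv v i j • b i) →
      (Matrix.of fun i j : Fin m × Fin m => (b i * b j).trace).det ≠ 0 ∧
      ∀ v, (Matrix.of fun i j : Fin m × Fin m => (b i * b j).trace).det • Cv v =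
        (Matrix.of fun i j : Fin m × Fin m => (b i * b j).trace).adjugate *
          Matrix.of fun i j : Fin m × Fin m => (b i * (M v * b j)).trace :=
  Summit.ValiantsHypothesis.ValiantsHypothesis.Theorems.stub_traceCramer

/-- **Stub L4 (integer adjugate bounds)**: Hadamard-free crude bounds `|det A| ≤ n!·K^n` and
`|adj A i j| ≤ n!·K^n` for an integer matrix with entries bounded by `K ≥ 1`. -/
theorem stub_adjugateEntryBound :
    ∀ (n : Type) [Fintype n] [DecidableEq n] (A : Matrix n n ℤ) (K : ℕ),
      1 ≤ K → (∀ i j, |A i j| ≤ K) →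
      |A.det| ≤ Nat.factorial (Fintype.card n) * K ^ Fintype.card n ∧
      ∀ i j, |A.adjugate i j| ≤ Nat.factorial (Fintype.card n) * K ^ Fintype.card n :=
  Summit.ValiantsHypothesis.ValiantsHypothesis.Theorems.stub_adjugateEntryBound

/-- **Stub L5 (lift assembly)**: the four statements L1–L4 imply the FREE-DENOMINATOR LIFT: an
absolutely irreducible tuple with `ℤ[1/N]`-valued bounded character admits integer matrices `Z_v`
of size `m²`, a denominator `1 ≤ D ≤ 2^poly(m + #ι + h)` and entries `≤ 2^poly`, with
`det (X₀·1 + Σ_v X_v Z_v / D) = det (X₀·1 + Σ_v X_v M_v)^r`, `r ≥ 1` (word basis `b` from L1,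
coordinates `C_v`, `D = |det G̃|`, `Z_v = ± adj G̃ · T̃_v` for the integerised Gram data, L2 for the
determinant, L4 for the heights). -/
theorem stub_liftAssembly :
    (∀ (ι : Type) [Fintype ι] [DecidableEq ι] (m : ℕ) (M : ι → Matrix (Fin m) (Fin m) ℂ),
      Submodule.span ℂ (Set.range fun w : List ι => (w.map M).prod) = ⊤ →
      ∃ b : Fin m × Fin m → List ι,
        (∀ i, (b i).length ≤ m * m) ∧ LinearIndependent ℂ (fun i => ((b i).map M).prod)) →
    (∀ (ι : Type) [Fintype ι] [DecidableEq ι] (m : ℕ) (M : ι → Matrix (Fin m) (Fin m) ℂ)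
      (b : Fin m × Fin m → Matrix (Fin m) (Fin m) ℂ)
      (Cv : ι → Matrix (Fin m × Fin m) (Fin m × Fin m) ℂ),
      LinearIndependent ℂ b →
      (∀ v j, M v * b j = ∑ i, Cv v i j • b i) →
      ((MvPolynomial.X none : MvPolynomial (Option ι) ℂ) •
            (1 : Matrix (Fin m × Fin m) (Fin m × Fin m) (MvPolynomial (Option ι) ℂ)) +
          ∑ v : ι, (MvPolynomial.X (some v) : MvPolynomial (Option ι) ℂ) •
            (Cv v).map (MvPolynomial.C : ℂ →+* MvPolynomial (Option ι) ℂ)).det =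
        (((MvPolynomial.X none : MvPolynomial (Option ι) ℂ) •
              (1 : Matrix (Fin m) (Fin m) (MvPolynomial (Option ι) ℂ)) +
            ∑ v : ι, (MvPolynomial.X (some v) : MvPolynomial (Option ι) ℂ) •
              (M v).map (MvPolynomial.C : ℂ →+* MvPolynomial (Option ι) ℂ)).det) ^ m) →
    (∀ (ι : Type) [Fintype ι] [DecidableEq ι] (m : ℕ) (M : ι → Matrix (Fin m) (Fin m) ℂ)
      (b : Fin m × Fin m → Matrix (Fin m) (Fin m) ℂ)
      (Cv : ι → Matrix (Fin m × Fin m) (Fin m × Fin m) ℂ),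
      LinearIndependent ℂ b →
      (∀ v j, M v * b j = ∑ i, Cv v i j • b i) →
      (Matrix.of fun i j : Fin m × Fin m => (b i * b j).trace).det ≠ 0 ∧
      ∀ v, (Matrix.of fun i j : Fin m × Fin m => (b i * b j).trace).det • Cv v =
        (Matrix.of fun i j : Fin m × Fin m => (b i * b j).trace).adjugate *
          Matrix.of fun i j : Fin m × Fin m => (b i * (M v * b j)).trace) →
    (∀ (n : Type) [Fintype n] [DecidableEq n] (A : Matrix n n ℤ) (K : ℕ),
      1 ≤ K → (∀ i j, |A i j| ≤ K) →
      |A.det| ≤ Nat.factorial (Fintype.card n) * K ^ Fintype.card n ∧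
      ∀ i j, |A.adjugate i j| ≤ Nat.factorial (Fintype.card n) * K ^ Fintype.card n) →
    ∃ c : ℕ, ∀ (ι : Type) [Fintype ι] [DecidableEq ι] (m N h : ℕ) (M : ι → Matrix (Fin m) (Fin m) ℂ),
      1 ≤ N → N ≤ 2 ^ h →
      Submodule.span ℂ (Set.range fun w : List ι => (w.map M).prod) = ⊤ →
      (∀ w : List ι, ∃ (z : ℤ) (e : ℕ), ((w.map M).prod).trace = (z : ℂ) / (N : ℂ) ^ e ∧
          |z| ≤ 2 ^ (h * (w.length + 1)) ∧ e ≤ h * (w.length + 1)) →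
      ∃ (D r : ℕ) (Z : ι → Matrix (Fin m × Fin m) (Fin m × Fin m) ℤ),
        1 ≤ r ∧ 1 ≤ D ∧ D ≤ 2 ^ ((m + Fintype.card ι + h + 2) ^ c) ∧
        (∀ v a b, |Z v a b| ≤ 2 ^ ((m + Fintype.card ι + h + 2) ^ c)) ∧
        ((MvPolynomial.X none : MvPolynomial (Option ι) ℂ) •
              (1 : Matrix (Fin m × Fin m) (Fin m × Fin m) (MvPolynomial (Option ι) ℂ)) +
            ∑ v : ι, (MvPolynomial.X (some v) : MvPolynomial (Option ι) ℂ) •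
              (Z v).map (fun z : ℤ => (MvPolynomial.C ((z : ℂ) / (D : ℂ)) : MvPolynomial (Option ι) ℂ))).det =
          (((MvPolynomial.X none : MvPolynomial (Option ι) ℂ) •
                (1 : Matrix (Fin m) (Fin m) (MvPolynomial (Option ι) ℂ)) +
              ∑ v : ι, (MvPolynomial.X (some v) : MvPolynomial (Option ι) ℂ) •
                (M v).map (MvPolynomial.C : ℂ →+* MvPolynomial (Option ι) ℂ)).det) ^ r :=
  Summit.ValiantsHypothesis.ValiantsHypothesis.Theorems.stub_liftAssembly

/-- **Stub glue' (free-denominator glue)**: `RationalCharacterNF → LiftFD → HeightToSize → IntDetQP`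
— the landed layer-1 glue `Theorems.intDetGlue_proof` re-run with the denominator `D` of the
free-denominator lift in place of `N^e` (substitute `X₀ ↦ 1, X_v ↦ x_v − δ_v`; integer model
`D·1 + Σ_v (x_v − δ_v) Z_v` with `det = D^(m'²)·per_n^r`; heights `≤ D + n²·2·2^K`; compress with
`HeightToSize`; compose the quasi-polynomial bounds). -/
theorem stub_glueFreeDenominator :
    RationalCharacterNF →
    (∃ c : ℕ, ∀ (ι : Type) [Fintype ι] [DecidableEq ι] (m N h : ℕ) (M : ι → Matrix (Fin m) (Fin m) ℂ),
      1 ≤ N → N ≤ 2 ^ h →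
      Submodule.span ℂ (Set.range fun w : List ι => (w.map M).prod) = ⊤ →
      (∀ w : List ι, ∃ (z : ℤ) (e : ℕ), ((w.map M).prod).trace = (z : ℂ) / (N : ℂ) ^ e ∧
          |z| ≤ 2 ^ (h * (w.length + 1)) ∧ e ≤ h * (w.length + 1)) →
      ∃ (D r : ℕ) (Z : ι → Matrix (Fin m × Fin m) (Fin m × Fin m) ℤ),
        1 ≤ r ∧ 1 ≤ D ∧ D ≤ 2 ^ ((m + Fintype.card ι + h + 2) ^ c) ∧
        (∀ v a b, |Z v a b| ≤ 2 ^ ((m + Fintype.card ι + h + 2) ^ c)) ∧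
        ((MvPolynomial.X none : MvPolynomial (Option ι) ℂ) •
              (1 : Matrix (Fin m × Fin m) (Fin m × Fin m) (MvPolynomial (Option ι) ℂ)) +
            ∑ v : ι, (MvPolynomial.X (some v) : MvPolynomial (Option ι) ℂ) •
              (Z v).map (fun z : ℤ => (MvPolynomial.C ((z : ℂ) / (D : ℂ)) : MvPolynomial (Option ι) ℂ))).det =
          (((MvPolynomial.X none : MvPolynomial (Option ι) ℂ) •
                (1 : Matrix (Fin m) (Fin m) (MvPolynomial (Option ι) ℂ)) +
              ∑ v : ι, (MvPolynomial.X (some v) : MvPolynomial (Option ι) ℂ) •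
                (M v).map (MvPolynomial.C : ℂ →+* MvPolynomial (Option ι) ℂ)).det) ^ r) →
    HeightToSize →
      (Literature.Computability.AlgebraicComplexity.VP ℂ = Literature.Computability.AlgebraicComplexity.VNP ℂ →
        ∃ c n₀ : ℕ, ∀ n ≥ n₀, ∃ (m d : ℕ) (N : ℤ) (A : Matrix (Fin m) (Fin m) (MvPolynomial (Fin n × Fin n) ℤ)),
          1 ≤ d ∧ m ≤ 2 ^ ((Nat.log 2 n + c) ^ c) ∧ N ≠ 0 ∧ (∀ i j, (A i j).totalDegree ≤ 1) ∧
          (∀ i j s, |MvPolynomial.coeff s (A i j)| ≤ 1) ∧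
          A.det = MvPolynomial.C N * Literature.Computability.AlgebraicComplexity.perPoly (Fin n) ℤ ^ d) :=
  Summit.ValiantsHypothesis.ValiantsHypothesis.Theorems.stub_glueFreeDenominator

/-! ## §2 Composition -/

/-- **The line closes the crux**: from the route item `RationalCharacterNF` (by name) the crux
`IntegralOrbits.IntDetQP` follows, using inside the proof the registered stubs L1–L5 (free-denominator
lift) and glue', fed with the LANDED support `Theorems.heightToSize_proof : HeightToSize`
(stmt-ValiantsHypothesis-7681). The glue stub states the crux body unfolded; `IntDetQP` is that body
by `rfl`. -/
theorem IntDetQP_of :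
    RationalCharacterNF → Summit.ValiantsHypothesis.ValiantsHypothesis.Theses.IntegralOrbits.IntDetQP :=
  fun hNF =>
    stub_glueFreeDenominator hNF
      (stub_liftAssembly stub_shortWordBasis stub_regularPencilDet stub_traceCramer
        stub_adjugateEntryBound)
      Summit.ValiantsHypothesis.ValiantsHypothesis.Theorems.heightToSize_proof

/-- **The skeleton**: `IntegralOrbits.IntDetQP` BY NAME, modulo exactly the registered stubs. -/
theorem IntDetQP_proof : Summit.ValiantsHypothesis.ValiantsHypothesis.Theses.IntegralOrbits.IntDetQP :=
  IntDetQP_of stub_rationalCharacterNF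

end Summit.ValiantsHypothesis.ValiantsHypothesis.Cruxes.IntDetQP.Birth

end
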